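import Mathlib
import Literature.MathematicalPhysics.QuantumFieldTheory.Balaban1983to89.B14Sect3
import Literature.MathematicalPhysics.QuantumFieldTheory.Balaban1983to89.B14Seam245

/-!
# `Balaban1983to89.B14TentUnity` — [Balaban1988Convergent] (3.40) p. 275 in `d` dimensions and (3.65) p. 283:
the tent decomposition of unity `Σ_z h_z = 1` and the localized decomposition `A(φ_j, U_k) = Σ_z A(h_zφ_j, U_k)`

statement-level skeleton of published theorems with citation tags; proofs where landed; nothing here is a
claim about the Yang–Mills mass gap

CITATION HEADER (lean-in-tree rule).  Source: T. Bałaban, *Convergent renormalization expansions for lattice gauge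
theories*, Commun. Math. Phys. **119**, 243–285 (1988), doi:10.1007/bf01217741 [Balaban1988Convergent] (cell paper
B14; held `paper:balaban1988-cmp119-convergent-renormalization`, journal page = PDF page + 242; displays read on the
x2 renders p033 (p. 275) and p041 (p. 283) of `run/shared/lean/pub/pub-balaban/b2b-balaban-ref1/pages/1988-cmp119-…/`).
Mega-formalization `lit-balaban`, unit `lit-balaban-r11` (CMP 119), SKELETON rows B14-3.40 and B14-3.65.

THE PRINTED TEXT (verbatim).
* p. 275 [PDF 33]: *"Next we introduce functions h_z on the lattice T₁^{(k)}, for z ∈ T_L^{(k+1)}: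
  h_z(x) = Π_{μ=1}^{d} h(x_μ − z_μ), h(t) = max{1 − L^{−1}|t|, 0}. (3.40)  They form a decomposition of unity:
  Σ_z h_z = 1."*
* p. 283 [PDF 41]: *"Consider now the term −β_jA(φ_j, U_k). We decompose it into the sum of localized expressions
  A(φ_j, U_k) = Σ_{z∈T^{(j)}} A(h_zφ_j, U_k), (3.65)  where h_z is defined as in (3.40), but on the lattice T_{L^{−j}},
  and with h(t) = max{1 − |t|, 0}. For z ∈ Λ_j⁰ we have h_zφ_j = h_z, and the function A(h_z, U_j) is Euclidean
  covariant."*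

WHAT IS PROVED (kernel-checked, no `sorry`, no axiom; nothing printed is asserted beyond these identities).
* `tentD_decomposition_unity` — the `d`-dimensional decomposition of unity of (3.40): for every `x ∈ ℝ^d` and `L > 0`,
  `Σ_{n ∈ ℤ^d} Π_μ h(x_μ − L n_μ) = 1`, the centres `z = L n` running over the spacing-`L` lattice `L ℤ^d` (the
  sites of `T_L^{(k+1)}` seen from `T₁^{(k)}`, on the infinite lattice; the torus statement is its periodization).
  The one-dimensional factor is `B14Sect3.tent_partition_unity` (sibling module `B14Sect3`, whose docstring records
  *"the d-dimensional statement is the product"* — supplied here): only the `2^d` centres of the window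
  `{⌊x_μ/L⌋, ⌊x_μ/L⌋+1}^d` contribute, and the finite sum factorizes (`Finset.prod_univ_sum`).
* `weightedAction_decomposition` — (3.65) for the weighted Wilson action `B14Seam245.weightedAction`
  (`A(ψ, U) = Σ_p ψ(x(p))·w(p)`, p. 253): ANY finite family `h_z`, `z ∈ T`, with `Σ_{z∈T} h_z(y) = 1` at every
  initial point `y = x(p)` gives `A(φ, U) = Σ_{z∈T} A(h_zφ, U)` — linearity of `A(·, U)` in the weight (p. 253) and
  the exchange of two finite sums.
-/

namespace Literature.MathematicalPhysics.QuantumFieldTheory.Balaban1983to89.B14.TentUnity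

open Literature.MathematicalPhysics.QuantumFieldTheory.Balaban1983to89
open scoped BigOperators

/-! ## (3.40) in `d` dimensions -/

/-- **(3.40) p. 275**: `h_z(x) = Π_{μ=1}^{d} h(x_μ − z_μ)` with the one-dimensional tent `h(t) = max{1 − L⁻¹|t|, 0}`
(`B14Sect3.tent L t`), the centre `z = L·n`, `n ∈ ℤ^d`, on the spacing-`L` lattice. [cite: Balaban1988Convergent, (3.40) p.275] -/
noncomputable def tentD {d : ℕ} (L : ℝ) (x : Fin d → ℝ) (n : Fin d → ℤ) : ℝ :=
  ∏ μ, B14Sect3.tent L (x μ - L * n μ)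

/-- The window of the two lattice centres nearest to `t/L`: `{⌊t/L⌋, ⌊t/L⌋ + 1}` — the only centres whose tents
(3.40) do not vanish at `t`. [cite: Balaban1988Convergent, (3.40) p.275] -/
noncomputable def window (L t : ℝ) : Finset ℤ := {⌊t / L⌋, ⌊t / L⌋ + 1}

/-- Off the window the one-dimensional tent (3.40) vanishes: `h(t − Lz) = 0` for `z ∉ {⌊t/L⌋, ⌊t/L⌋+1}`.
[cite: Balaban1988Convergent, (3.40) p.275] -/
theorem tent_eq_zero_off_window (L t : ℝ) (hL : 0 < L) (z : ℤ) (hz : z ∉ window L t) :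
    B14Sect3.tent L (t - L * z) = 0 := by
  set m : ℤ := ⌊t / L⌋ with hm
  have hm1 : (m : ℝ) ≤ t / L := Int.floor_le _
  have hm2 : t / L < m + 1 := Int.lt_floor_add_one _
  have hx1 : L * m ≤ t := by rwa [le_div_iff₀ hL, mul_comm] at hm1
  have hx2 : t < L * (m + 1) := by rwa [div_lt_iff₀ hL, mul_comm] at hm2
  simp only [window, Finset.mem_insert, Finset.mem_singleton, not_or] at hz
  apply B14Sect3.tent_eq_zero_of_le L _ hL
  rcases lt_or_gt_of_ne hz.1 with h | h
  · have hz' : (z : ℝ) ≤ m - 1 := by exact_mod_cast (show z ≤ m - 1 by omega)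
    have : L ≤ t - L * z := by nlinarith
    rw [abs_of_nonneg (by linarith)]; exact this
  · have hz' : (m : ℝ) + 2 ≤ z := by exact_mod_cast (show m + 2 ≤ z by omega)
    have : L ≤ -(t - L * z) := by nlinarith
    rw [abs_of_nonpos (by linarith)]; exact this

/-- The one-dimensional decomposition of unity as a FINITE sum over the window (from `B14Sect3.tent_partition_unity`).
[cite: Balaban1988Convergent, (3.40) p.275] -/
theorem sum_window_tent_eq_one (L t : ℝ) (hL : 0 < L) :
    ∑ z ∈ window L t, B14Sect3.tent L (t - L * z) = 1 := by
  have h := B14Sect3.tent_partition_unity L t hL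
  rwa [tsum_eq_sum (s := window L t) (fun z hz => tent_eq_zero_off_window L t hL z hz)] at h

/-- Off the product window `Π_μ {⌊x_μ/L⌋, ⌊x_μ/L⌋+1}` the `d`-dimensional tent (3.40) vanishes.
[cite: Balaban1988Convergent, (3.40) p.275] -/
theorem tentD_eq_zero_off_window {d : ℕ} (L : ℝ) (hL : 0 < L) (x : Fin d → ℝ) (n : Fin d → ℤ)
    (hn : n ∉ Fintype.piFinset fun μ => window L (x μ)) : tentD L x n = 0 := by
  obtain ⟨μ, hμ⟩ : ∃ μ, n μ ∉ window L (x μ) := by simpa [Fintype.mem_piFinset] using hn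
  unfold tentD
  exact Finset.prod_eq_zero (Finset.mem_univ μ) (tent_eq_zero_off_window L (x μ) hL (n μ) hμ)

/-- **(3.40), "They form a decomposition of unity: Σ_z h_z = 1"**, in `d` dimensions: for every `x ∈ ℝ^d` and
`L > 0`, `Σ_{n∈ℤ^d} Π_{μ=1}^{d} h(x_μ − L n_μ) = 1`. [cite: Balaban1988Convergent, (3.40) p.275] -/
theorem tentD_decomposition_unity {d : ℕ} (L : ℝ) (hL : 0 < L) (x : Fin d → ℝ) :
    ∑' n : Fin d → ℤ, tentD L x n = 1 := by
  rw [tsum_eq_sum (s := Fintype.piFinset fun μ => window L (x μ))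
        (fun n hn => tentD_eq_zero_off_window L hL x n hn)]
  unfold tentD
  rw [← Finset.prod_univ_sum (fun μ => window L (x μ)) (fun μ z => B14Sect3.tent L (x μ - L * (z : ℝ)))]
  exact Finset.prod_eq_one (fun μ _ => sum_window_tent_eq_one L (x μ) hL)

/-- Non-negativity `h_z ≥ 0` of the `d`-dimensional tent (3.40) (each factor is a `max{·, 0}`).
[cite: Balaban1988Convergent, (3.40) p.275] -/
theorem tentD_nonneg {d : ℕ} (L : ℝ) (x : Fin d → ℝ) (n : Fin d → ℤ) : 0 ≤ tentD L x n :=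
  Finset.prod_nonneg fun μ _ => by unfold B14Sect3.tent; exact le_max_right _ _

/-! ## (3.65): the localized decomposition of the weighted action -/

/-- **(3.65) p. 283**: `A(φ_j, U_k) = Σ_{z∈T^{(j)}} A(h_zφ_j, U_k)` — for the weighted Wilson action
`A(ψ, U) = Σ_p ψ(x(p))·w(p)` (`B14Seam245.weightedAction`, p. 253) and any finite family of functions `h_z`, `z ∈ T`,
forming a decomposition of unity `Σ_{z∈T} h_z(y) = 1` at the initial points `y = x(p)` of the plaquettes
((3.40) on the torus `T^{(j)}`).  Content: linearity in the weight and `Σ_p Σ_z = Σ_z Σ_p`. [cite: Balaban1988Convergent, (3.65) p.283, (3.40) p.275, p.253] -/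
theorem weightedAction_decomposition {P X Z : Type*} (plaq : Finset P) (x : P → X) (w : P → ℝ) (φ : X → ℝ)
    (T : Finset Z) (h : Z → X → ℝ) (hunity : ∀ p ∈ plaq, ∑ z ∈ T, h z (x p) = 1) :
    B14Seam245.weightedAction plaq x w φ =
      ∑ z ∈ T, B14Seam245.weightedAction plaq x w (fun y => h z y * φ y) := by
  unfold B14Seam245.weightedAction
  rw [Finset.sum_comm]
  refine Finset.sum_congr rfl fun p hp => ?_
  rw [← Finset.sum_mul, ← Finset.sum_mul, hunity p hp, one_mul]

/-- (3.65) with p. 283's sentence *"For z ∈ Λ_j⁰ we have h_zφ_j = h_z"*: on the part `Ω ⊆ T` of the centres where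
`h_zφ = h_z` the localized terms are `A(h_z, U)`:
`A(φ, U) = Σ_{z∈Ω} A(h_z, U) + Σ_{z∈T∖Ω} A(h_zφ, U)`. [cite: Balaban1988Convergent, (3.65) p.283] -/
theorem weightedAction_decomposition_split {P X Z : Type*} [DecidableEq Z] (plaq : Finset P) (x : P → X)
    (w : P → ℝ) (φ : X → ℝ) (T Ω : Finset Z) (hΩ : Ω ⊆ T) (h : Z → X → ℝ)
    (hunity : ∀ p ∈ plaq, ∑ z ∈ T, h z (x p) = 1) (hΛ0 : ∀ z ∈ Ω, ∀ y, h z y * φ y = h z y) :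
    B14Seam245.weightedAction plaq x w φ =
      ∑ z ∈ Ω, B14Seam245.weightedAction plaq x w (h z) +
        ∑ z ∈ T \ Ω, B14Seam245.weightedAction plaq x w (fun y => h z y * φ y) := by
  rw [weightedAction_decomposition plaq x w φ T h hunity, ← Finset.sum_sdiff hΩ, add_comm]
  congr 1
  refine Finset.sum_congr rfl fun z hz => ?_
  congr 1
  funext y
  exact hΛ0 z hz y

end Literature.MathematicalPhysics.QuantumFieldTheory.Balaban1983to89.B14.TentUnity
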